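import Summits.ResolutionOfSingularities.ResolutionOfSingularities.Theses.WildPurity
import HarnessLib

/-!
# Route `WildPurity`, crux `WildSymbol` (stmt-ResolutionOfSingularities-17133), line `birth` — definitions

Objects posited by the line `birth` (`Cruxes/WildSymbol/Lines/birth.lean`, periodic-tower cut of the
crux `Summit.ResolutionOfSingularities.ResolutionOfSingularities.Theses.WildPurity.WildSymbol`), so that
the registered stubs `stub_periodicTransport`, `stub_selfSimilarGerm` and the calibration lemmas of the
line can be stated BY NAME in `Theorems/` files. Every body below is copied VERBATIM from the route file
(`G`, `N`, `Unr`, `DivIntegral`, `EssFiniteType` are the route's own `let`s / clauses) or from the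
registered skeleton (`locAt`, `tripleMap`, `PeriodicTower`), so that the line's composition
`WildSymbol_of` stays definitional unfolding: `N p K` IS the route's relation subgroup (`N_eq` below,
`rfl`), and the crux restates over these names by `Iff.rfl` (`wildSymbol_iff`).

* `G K` — generators of Kato's symbolic `H³_p(K)`: the free abelian group on triples `(a, b, c)`,
  `a ∈ K`, `b, c ∈ Kˣ` (the symbol `[a, b, c} = a · dlog b ∧ dlog c`).
* `N p K` — Kato's seven relation shapes (additive in `a`, multiplicative in `b` and in `c`,
  `[a,b,b} = [b,b,c} = [c,b,c} = 0`, `[a^p − a, b, c} = 0`); `G K ⧸ N p K = H³_p(K) = H¹(K, Ω²_log)`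
  (Kato 1982 §1; Bloch–Kato 1986 Lemma 4.2 — transcription audited on the page by the refuters).
* `Unr p K T` — the subgroup of `G ⧸ N` generated by the `T`-INTEGRAL symbols (`a ∈ T`, `b, c ∈ Tˣ`).
* `EssFiniteType k K W` — "`W` is essentially of finite type over `k`" (a localisation of a finitely
  generated `k`-subalgebra `B ⊆ W`), the crux's clause.
* `DivIntegral p k K R O α` — condition (D) of the crux: `α` is `W`-integral at every divisorial
  valuation ring `W ⊇ R` of `K/k` centred inside the centre of `O`.
* `locAt R O` — the local ring of the affine model `R` at the centre of `O`, as a subring of `K`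
  (verbatim the construction in the route's support item `LocalCandidate`).
* `tripleMap σ` — a ring automorphism acting on symbol generators.
* `PeriodicTower p K σ O S α` — (i) chart step `S ⊆ σ(S)`, (ii) `O` exhausted by `⋃ₙ σⁿ(S)`,
  (iii) `α` is `σ`-invariant (on a lift).

No theorem of this file concludes the crux; the two sanity statements are `rfl` / `Iff.rfl`.
-/

noncomputable section

-- single-problem summit: the doubled namespace component `ResolutionOfSingularities` is forced
set_option linter.dupNamespace false

namespace Summit.ResolutionOfSingularities.ResolutionOfSingularities.Theorems.WildSymbol.Birth

open Summit.ResolutionOfSingularities.ResolutionOfSingularities.Theses.WildPurity (WildSymbol)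

/-! ## Kato's symbolic `H³_p(K)` — the route's `let`s as named declarations (bodies verbatim) -/

/-- Generators of Kato's symbolic `H³_p(K)`: the free abelian group on triples `(a, b, c)`,
`a ∈ K`, `b, c ∈ Kˣ` (the symbol `[a, b, c} = a · dlog b ∧ dlog c`). Verbatim the route's `let G`.
[cite: Kato1982, §1] -/
abbrev G (K : Type) [Field K] : Type := FreeAbelianGroup (K × Kˣ × Kˣ)

/-- Kato's relations: additive in `a`, multiplicative in `b` and in `c`, `[a,b,b} = [b,b,c} = [c,b,c} = 0`,
`[a^p − a, b, c} = 0`. Verbatim the route's `let N`, so `N p K` is definitionally the route's subgroup and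
`G K ⧸ N p K` is the route's `H³_p(K)`. [cite: BlochKato1986, Lemma 4.2] -/
def N (p : ℕ) (K : Type) [Field K] : AddSubgroup (G K) :=
  AddSubgroup.closure { x | (∃ (a a' : K) (b c : Kˣ), x = .of (a + a', b, c) - .of (a, b, c) - .of (a', b, c)) ∨ (∃ (a : K) (b b' c : Kˣ), x = .of (a, b * b', c) - .of (a, b, c) - .of (a, b', c)) ∨ (∃ (a : K) (b c c' : Kˣ), x = .of (a, b, c * c') - .of (a, b, c) - .of (a, b, c')) ∨ (∃ (a : K) (b : Kˣ), x = .of (a, b, b)) ∨ (∃ (b c : Kˣ), x = .of ((b : K), b, c)) ∨ (∃ (b c : Kˣ), x = .of ((c : K), b, c)) ∨ (∃ (a : K) (b c : Kˣ), x = .of (a ^ p - a, b, c)) }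

/-- `Unr p K T ⊆ H³_p(K)`: the subgroup generated by the `T`-INTEGRAL symbols (`a ∈ T`, `b, c ∈ Tˣ`).
Verbatim the route's `let Unr`. [cite: BlochKato1986, Lemma 4.2] -/
def Unr (p : ℕ) (K : Type) [Field K] (T : Subring K) : AddSubgroup (G K ⧸ N p K) :=
  AddSubgroup.closure { y | ∃ (a : K) (b c : Kˣ), a ∈ T ∧ (b : K) ∈ T ∧ ((b⁻¹ : Kˣ) : K) ∈ T ∧ (c : K) ∈ T ∧ ((c⁻¹ : Kˣ) : K) ∈ T ∧ y = ((FreeAbelianGroup.of (a, b, c) : G K) : G K ⧸ N p K) }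

/-- Sanity: `N p K` IS the route's relation subgroup, definitionally. [folklore] -/
theorem N_eq (p : ℕ) (K : Type) [Field K] :
    N p K = (let G := FreeAbelianGroup (K × Kˣ × Kˣ); (AddSubgroup.closure { x | (∃ (a a' : K) (b c : Kˣ), x = .of (a + a', b, c) - .of (a, b, c) - .of (a', b, c)) ∨ (∃ (a : K) (b b' c : Kˣ), x = .of (a, b * b', c) - .of (a, b, c) - .of (a, b', c)) ∨ (∃ (a : K) (b c c' : Kˣ), x = .of (a, b, c * c') - .of (a, b, c) - .of (a, b, c')) ∨ (∃ (a : K) (b : Kˣ), x = .of (a, b, b)) ∨ (∃ (b c : Kˣ), x = .of ((b : K), b, c)) ∨ (∃ (b c : Kˣ), x = .of ((c : K), b, c)) ∨ (∃ (a : K) (b c : Kˣ), x = .of (a ^ p - a, b, c)) } : AddSubgroup G)) :=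
  rfl

/-! ## The crux's clauses, named -/

/-- "`W` is essentially of finite type over `k`": `W` is a localisation of a finitely generated
`k`-subalgebra `B ⊆ W` (verbatim the crux's clause on the tested valuation rings `W`). [folklore] -/
def EssFiniteType (k K : Type) [Field k] [Field K] [Algebra k K] (W : ValuationSubring K) : Prop :=
  ∃ B : Subalgebra k K, B.FG ∧ B.toSubring ≤ W.toSubring ∧
    ∀ x : K, x ∈ W → ∃ b s : K, b ∈ B ∧ s ∈ B ∧ s ∉ W.nonunits ∧ x * s = b

/-- **Condition (D) of the crux, verbatim**: `α` is `W`-integral for every divisorial valuation ring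
`W` of `K/k` (`k ⊆ W`, `W` a DVR essentially of finite type over `k`) containing `R` whose centre on `R`
lies inside the centre of `O`. [cite: GrosSuwa1988, Introduction] -/
def DivIntegral (p : ℕ) (k K : Type) [Field k] [Field K] [Algebra k K] (R : Subalgebra k K)
    (O : ValuationSubring K) (α : G K ⧸ N p K) : Prop :=
  ∀ W : ValuationSubring K, (∀ c : k, algebraMap k K c ∈ W) → IsDiscreteValuationRing W → (∃ B : Subalgebra k K, B.FG ∧ B.toSubring ≤ W.toSubring ∧ ∀ x : K, x ∈ W → ∃ b s : K, b ∈ B ∧ s ∈ B ∧ s ∉ W.nonunits ∧ x * s = b) → R.toSubring ≤ W.toSubring → (∀ x : K, x ∈ R → x ∈ W.nonunits → x ∈ O.nonunits) → α ∈ Unr p K W.toSubring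

/-- **The crux over the named pieces** (definitional unfolding of the route's `let`s; `Iff.rfl`):
importers may `rw [wildSymbol_iff]`. [folklore] -/
theorem wildSymbol_iff : WildSymbol ↔ ∃ p : ℕ, p.Prime ∧ ∃ (k K : Type) (_ : Field k) (_ : CharP k p)
    (_ : PerfectField k) (_ : Field K) (_ : Algebra k K), (⊤ : IntermediateField k K).FG ∧
    ∃ O : ValuationSubring K, (∀ c : k, algebraMap k K c ∈ O) ∧ ∃ R : Subalgebra k K, R.FG ∧
    R.toSubring ≤ O.toSubring ∧ IsFractionRing R K ∧
    ∃ α : G K ⧸ N p K, DivIntegral p k K R O α ∧ α ∉ Unr p K O.toSubring :=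
  Iff.rfl

/-! ## The objects of the periodic-tower cut -/

/-- The local ring of the affine model `R` at the centre of the valuation ring `O`, as a subring of
`K`: generated by the fractions `r/s`, `r, s ∈ R`, `s` a unit of `O` (verbatim the construction in the
route's support item `LocalCandidate`). [folklore] -/
def locAt {K : Type} [Field K] (R : Set K) (O : ValuationSubring K) : Subring K :=
  Subring.closure { x : K | ∃ r s : K, r ∈ R ∧ s ∈ R ∧ s ∉ O.nonunits ∧ x * s = r }

/-- A ring automorphism of `K` acting on symbol generators: `(a, b, c) ↦ (σ a, σ b, σ c)`. [folklore] -/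
def tripleMap {K : Type} [Field K] (σ : K ≃+* K) : K × Kˣ × Kˣ → K × Kˣ × Kˣ :=
  fun t => (σ t.1, Units.map (σ : K →* K) t.2.1, Units.map (σ : K →* K) t.2.2)

/-- **Periodic tower** `(σ, O, S, α)`: (i) the chart step `S ⊆ σ(S)` (as `σ⁻¹ S ⊆ S`); (ii) the
valuation ring `O` is exhausted by the tower of iterated charts, `O ⊆ ⋃ₙ σⁿ(S)`; (iii) the class `α`
is `σ`-invariant, stated on a lift `g ∈ G` (no quotient action needed as data). In the intended
examples `S = locAt R O` is the local ring of a point, `Spec σ⁻¹` a birational self-map fixing it and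
contracting through it, and `O = ⋃ₙ σⁿ(S)` exactly (Hauser–Perlega's recurrent "kangaroo" picture made
algebraic). [cite: HauserPerlega2019, §1] -/
def PeriodicTower (p : ℕ) (K : Type) [Field K] (σ : K ≃+* K) (O : ValuationSubring K)
    (S : Subring K) (α : G K ⧸ N p K) : Prop :=
  (∀ x : K, x ∈ S → σ.symm x ∈ S) ∧
  (∀ x : K, x ∈ O → ∃ (n : ℕ) (y : K), y ∈ S ∧ x = σ^[n] y) ∧
  (∃ g : G K, (g : G K ⧸ N p K) = α ∧ ((FreeAbelianGroup.map (tripleMap σ) g : G K) : G K ⧸ N p K) = α)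

end Summit.ResolutionOfSingularities.ResolutionOfSingularities.Theorems.WildSymbol.Birth

end
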